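import Mathlib
import HarnessLib
import Summits.Parity.GeneralizedHardyLittlewood.Theses.SiegelSpectrumSplit

/-!
# Route `SiegelSpectrumSplit`, glue item `BoundedSiegelZeroQualityGlue` (stmt-Parity-25908)

The glue of the band split (split generation 1) of the blocker leaf
`Q = BoundedSiegelZeroQuality` (stmt-Parity-25148) of the decomp-parity node of record:
`HighBandZeroFree → LowBandZeroFree → BoundedSiegelZeroQuality`.

If the special band `σ > 1 − c₂ (log D)^{−2024}` (piece H, Zhang's claimed Theorem 2 shape) and the
generic band `1 − c/log D < σ ≤ 1 − (log D)^{−2025}` at conductors `D ≥ D₀` (piece L) are both free of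
real zeros of primitive quadratic characters, then every Siegel zero `1 − 1/(η log q)` at a conductor
`q ≥ max(D₀, 3, ⌈e^{1/c₂}⌉)` has quality `η < 1/c + 1`: above that quality the zero lies to the right of
the classical line `1 − c/log q`, hence in one of the two bands, which overlap once `c₂ log q ≥ 1`.
Pure real-number case split; no named fact.

Proof ported verbatim (exponent `A = 2024` fixed) from the decomp-parity lens-2 node file
`SiegelBandSplit.lean` (`boundedQuality_of_bands_at`, sha256 5ceeb149…, kernel-checked, axioms
`propext`, `Classical.choice`, `Quot.sound`), re-elaborated over the route decls of
`Theses/SiegelSpectrumSplit.lean` rev 1 (items stmt-Parity-25906, 25907, 25148).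
-/

namespace Summit.Parity.GeneralizedHardyLittlewood.Theses.SiegelSpectrumSplit

/-- **`BoundedSiegelZeroQualityGlue` holds** (stmt-Parity-25908): the two zero-free bands exhaust the
Siegel zeros — `HighBandZeroFree → LowBandZeroFree → BoundedSiegelZeroQuality`. With the witnesses
`c₂` of H and `c, D₀` of L, take `η₀ := 1/c + 1` and `q₀ := max D₀ (max 3 ⌈exp (1/c₂)⌉)`; a Siegel zero
`1 − 1/(η log q)` with `η ≥ η₀`, `q ≥ q₀` lies right of `1 − c/log q`; if it is right of
`1 − c₂/(log q)^2024` it contradicts H, otherwise `1/(log q)^2025 ≤ c₂/(log q)^2024` (as `c₂ log q ≥ 1`)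
puts it in the generic band and it contradicts L. -/
theorem boundedSiegelZeroQualityGlue_holds : BoundedSiegelZeroQualityGlue := by
  unfold BoundedSiegelZeroQualityGlue
  intro hH hL
  obtain ⟨c₂, hc₂, hZ⟩ := hH
  obtain ⟨c, hc, D₀, hB⟩ := hL
  refine ⟨1 / c + 1, max D₀ (max 3 (Nat.ceil (Real.exp (1 / c₂)))), fun q _ χ η hq hS => ?_⟩
  by_contra hη
  push Not at hη
  obtain ⟨hprim, hquad, h10, hL0⟩ := hS
  have hqD₀ : D₀ ≤ q := le_of_max_le_left hq
  have hq3 : 3 ≤ q := le_of_max_le_left (le_of_max_le_right hq)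
  have hqe : Nat.ceil (Real.exp (1 / c₂)) ≤ q := le_of_max_le_right (le_of_max_le_right hq)
  have hq1 : (1 : ℝ) < q := by exact_mod_cast (show 1 < q by omega)
  have hlog : 0 < Real.log (q : ℝ) := Real.log_pos hq1
  -- `log q ≥ 1/c₂`, i.e. `c₂ log q ≥ 1`: the two bands overlap
  have hlogc : 1 / c₂ ≤ Real.log (q : ℝ) := by
    have h1 : Real.exp (1 / c₂) ≤ q := le_trans (Nat.le_ceil _) (by exact_mod_cast hqe)
    exact (Real.le_log_iff_exp_le (by linarith)).mpr h1
  have hc₂log : 1 ≤ c₂ * Real.log (q : ℝ) := by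
    have h1 := mul_le_mul_of_nonneg_left hlogc hc₂.le
    rwa [mul_one_div_cancel hc₂.ne'] at h1
  have hη0 : 0 < η := by linarith
  -- the zero lies right of the classical line `1 − c/log q`
  have hcη : 1 < c * η := by
    have h1 : 1 / c < η := by linarith
    have h2 := (div_lt_iff₀ hc).1 h1
    linarith [mul_comm η c]
  have hσ : 1 - c / Real.log q < 1 - 1 / (η * Real.log q) := by
    have h3 : 1 / (η * Real.log q) < c / Real.log q := by
      rw [div_lt_div_iff₀ (by positivity) hlog]
      nlinarith
    linarith
  by_cases hband : 1 - c₂ / Real.log q ^ 2024 < 1 - 1 / (η * Real.log q)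
  · -- special band: contradicts H
    exact hZ q χ hq3 hquad hprim _ hband hL0
  · -- generic band: contradicts L
    push Not at hband
    refine hB q χ hqD₀ hquad hprim _ hσ ?_ hL0
    have hkey : 1 / Real.log (q : ℝ) ^ 2025 ≤ c₂ / Real.log (q : ℝ) ^ 2024 := by
      rw [div_le_div_iff₀ (by positivity) (by positivity)]
      have hsucc : Real.log (q : ℝ) ^ 2025 = Real.log (q : ℝ) ^ 2024 * Real.log (q : ℝ) :=
        pow_succ _ _
      rw [hsucc]
      nlinarith [pow_pos hlog 2024]
    linarith

end Summit.Parity.GeneralizedHardyLittlewood.Theses.SiegelSpectrumSplit
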